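import Summits.QuantumFields.YangMills.Theorems.SwapVirialDeficitZeroModeSigmaFourSmallBallScaling
import Literature.MathematicalPhysics.QuantumLattice.SU2HaarSmallBall
import Literature.MathematicalPhysics.QuantumFieldTheory.OneLinkTraceShift
import HarnessLib

/-!
# The FOLLOWER BOX of the joint blow-up (brick J4, follower half, of memo-24197-massive-mode-rung)
# (free-hands support of ⟨stmt-QuantumFields-24197⟩ `SwapVirialDeficit.SwapGluedStiffness`; companion of ✓`BlowUp.lintegral_haar_pi_eq_followerChart`)

In the follower chart a centred follower is `V = quatToSU2 (dilateIm t y)`, `y = (y₀, η) ∈ ℝ × ℝ³`, `‖dilateIm t y‖ < 1`.  The box of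
✓`SwapRing.swapCommBox_of_swapRingDeficit` (`‖V − 1‖_F ≤ K·t`, `K = 96L³√r` after the slice triangle) then confines `y` to a BOUNDED set UNIFORMLY in `t`:

* §1 `frobNorm_quatToSU2_sub_one_sq` — `‖Q v − 1‖²_F = 4(1 − re v/‖v‖)` (`v ≠ 0`; ✓`OneLinkTraceShift.card_sub_re_trace_eq`, ✓`trace_quatToSU2_re`);
* §2 ★★ `follower_box` — `‖D³_t y‖ < 1`, `D³_t y ≠ 0`, `‖Q(D³_t y) − 1‖_F ≤ K·t`, `t > 0` ⟹ `|re y| < 1 ∧ ‖Im y‖ ≤ K`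
  (`t²‖Im y‖²/ρ² = 1 − re²/ρ² ≤ 2(1 − re/ρ) ≤ K²t²/2`, `ρ = ‖D³_t y‖ < 1`; `‖Im y‖² = Σ im²` is ✓`WeakCouplingRates.sq_norm_im`, inlined); ★ `follower_re_pos` — moreover `0 < re y` once `K·t < 2`
  (the `t = 0` configuration of such a point is the centre itself, not its antipode: the sign condition of `Dom₀`);
* §3 `volume_followerBox_ne_top`, `pi_volume_followerBox_ne_top` — the box `{|re y| < 1, ‖Im y‖ ≤ K}` and its `ι`-fold product have finite Lebesgue
  measure: the follower factor of the weight `Φ_r` of hypothesis (D″) of ✓`BlowUp.smallBall_limit_real_of_blowUp_of_weight_ae`.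

HONEST LABEL: quaternion geometry (plan-level plumbing); NOT the fixed-`L` sharp law, NOT ⟨24197⟩; the Yang–Mills mass gap is NOT proved; no summit is proved by a line.
Seat ym-line-fcl-p3 g45 (cell ym-idea-1, free hands; item of record ⟨24085⟩ aside, untouched), `--supports stmt-QuantumFields-24197`.  THEOREMS ONLY (0 `def`, 0 `sorry`),
standard axioms; the series' local `ℍ` instances.  References: [folklore]; [cite: arXiv160201222, Lemma 7.2] (the Frobenius/trace identity).
-/

set_option autoImplicit false

noncomputable section

open MeasureTheory Quaternion Set
open scoped Quaternion ENNReal BigOperators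
open Literature.MathematicalPhysics.QuantumLattice
open Literature.MathematicalPhysics.QuantumFieldTheory (frobNorm frobNorm_nonneg)
open Literature.MathematicalPhysics.QuantumFieldTheory.OneLinkTraceShift (card_sub_re_trace_eq)
open Summit.QuantumFields.YangMills.Theorems.SwapTwistDeficit.ToronLog

attribute [local instance] Literature.Analysis.FluidPDE.Tao2016.quatMeasurableSpace
  Literature.Analysis.FluidPDE.Tao2016.quatBorelSpace
  Literature.MathematicalPhysics.QuantumLattice.secondCountableTopology_su2

namespace Summit.QuantumFields.YangMills.Theorems.SwapVirialDeficit.BlowUp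

open Summit.QuantumFields.YangMills.Theorems.SwapVirialDeficit.ZeroModeSigma (dilateIm dilateIm_apply norm_sq_dilateIm)

/-! ## §1 The Frobenius distance of a radial projection to the identity -/

/-- ★ `‖Q v − 1‖²_F = 4·(1 − re v/‖v‖)` for `v ≠ 0` (`Q = quatToSU2`): `‖U − 1‖²_F = 2(2 − Re tr U)` on `SU(2)` and `Re tr (Q v) = 2 re v/‖v‖`.
[cite: arXiv160201222, Lemma 7.2] -/
theorem frobNorm_quatToSU2_sub_one_sq {v : ℍ} (hv : v ≠ 0) :
    frobNorm (((quatToSU2 v : Matrix.specialUnitaryGroup (Fin 2) ℂ) : Matrix (Fin 2) (Fin 2) ℂ) - 1) ^ 2 = 4 * (1 - v.re / ‖v‖) := by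
  have hU : ((quatToSU2 v : Matrix.specialUnitaryGroup (Fin 2) ℂ) : Matrix (Fin 2) (Fin 2) ℂ) ∈ Matrix.unitaryGroup (Fin 2) ℂ :=
    (Matrix.mem_specialUnitaryGroup_iff.1 (quatToSU2 v).2).1
  have h := card_sub_re_trace_eq hU
  rw [trace_quatToSU2_re hv] at h
  have h2 : frobNorm (((quatToSU2 v : Matrix.specialUnitaryGroup (Fin 2) ℂ) : Matrix (Fin 2) (Fin 2) ℂ) - 1) ^ 2 =
      2 * ((2 : ℕ) - 2 * (‖v‖⁻¹ * v.re)) := by linarith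
  rw [h2, div_eq_inv_mul]
  push_cast
  ring

/-! ## §2 The box in the blown-up follower coordinates -/

/-- ★★ **THE FOLLOWER BOX**: if `t > 0`, `v = D³_t y ≠ 0` lies in the unit ball and `‖Q v − 1‖_F ≤ K·t`, then `|re y| < 1` and `‖Im y‖ ≤ K` —
uniformly in `t`. [folklore] -/
theorem follower_box {t K : ℝ} (ht : 0 < t) (hK : 0 ≤ K) {y : ℍ} (hball : ‖dilateIm t y‖ < 1) (hv : dilateIm t y ≠ 0)
    (hfd : frobNorm (((quatToSU2 (dilateIm t y) : Matrix.specialUnitaryGroup (Fin 2) ℂ) : Matrix (Fin 2) (Fin 2) ℂ) - 1) ≤ K * t) :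
    |y.re| < 1 ∧ ‖y.im‖ ≤ K := by
  set ρ : ℝ := ‖dilateIm t y‖ with hρ
  have hρ0 : 0 < ρ := norm_pos_iff.2 hv
  have hρ1 : ρ < 1 := hball
  have him : ‖y.im‖ ^ 2 = y.imI ^ 2 + y.imJ ^ 2 + y.imK ^ 2 := by
    rw [sq_norm_eq_sum_sq]; simp
  have hρsq : ρ ^ 2 = y.re ^ 2 + t ^ 2 * ‖y.im‖ ^ 2 := by rw [hρ, norm_sq_dilateIm, him]
  have hre : (dilateIm t y).re = y.re := by rw [dilateIm_apply]
  -- `4(1 − re/ρ) ≤ K²t²`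
  have hsq : 4 * (1 - y.re / ρ) ≤ (K * t) ^ 2 := by
    rw [← hre, hρ, ← frobNorm_quatToSU2_sub_one_sq hv]
    exact pow_le_pow_left₀ (frobNorm_nonneg _) hfd 2
  -- `|re y| ≤ ρ < 1`
  have hre_le : |y.re| ≤ ρ := by
    rw [← Real.sqrt_sq_eq_abs, hρ, ← Real.sqrt_sq (norm_nonneg _), norm_sq_dilateIm]
    exact Real.sqrt_le_sqrt (by nlinarith [sq_nonneg y.imI, sq_nonneg y.imJ, sq_nonneg y.imK, sq_nonneg t])
  refine ⟨lt_of_le_of_lt hre_le hρ1, ?_⟩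
  -- `t²‖Im y‖² = ρ² − re² = (ρ − re)(ρ + re) ≤ (ρ − re)·2ρ ≤ (K²t²/4)·ρ·2ρ`
  have hreρ : y.re ≤ ρ := le_trans (le_abs_self _) hre_le
  have hreρ' : -ρ ≤ y.re := by linarith [neg_abs_le y.re, hre_le]
  have h1 : ρ - y.re ≤ (K * t) ^ 2 / 4 * ρ := by
    have : 1 - y.re / ρ ≤ (K * t) ^ 2 / 4 := by linarith
    have h' := mul_le_mul_of_nonneg_right this hρ0.le
    rwa [sub_mul, one_mul, div_mul_cancel₀ _ hρ0.ne'] at h'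
  have h2 : t ^ 2 * ‖y.im‖ ^ 2 ≤ (K * t) ^ 2 / 4 * ρ * (2 * ρ) := by
    have e : t ^ 2 * ‖y.im‖ ^ 2 = (ρ - y.re) * (ρ + y.re) := by
      rw [show (ρ - y.re) * (ρ + y.re) = ρ ^ 2 - y.re ^ 2 by ring, hρsq]; ring
    rw [e]
    calc (ρ - y.re) * (ρ + y.re) ≤ (K * t) ^ 2 / 4 * ρ * (ρ + y.re) := by
          exact mul_le_mul_of_nonneg_right h1 (by linarith)
      _ ≤ (K * t) ^ 2 / 4 * ρ * (2 * ρ) := by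
          exact mul_le_mul_of_nonneg_left (by linarith) (by positivity)
  -- hence `‖Im y‖² ≤ K² ρ²/2 ≤ K²`
  have h3 : ‖y.im‖ ^ 2 ≤ K ^ 2 := by
    have ht2 : 0 < t ^ 2 := by positivity
    have h4 : t ^ 2 * ‖y.im‖ ^ 2 ≤ t ^ 2 * (K ^ 2 * ρ ^ 2 / 2) := by
      calc t ^ 2 * ‖y.im‖ ^ 2 ≤ (K * t) ^ 2 / 4 * ρ * (2 * ρ) := h2
        _ = t ^ 2 * (K ^ 2 * ρ ^ 2 / 2) := by ring
    have h5 : ‖y.im‖ ^ 2 ≤ K ^ 2 * ρ ^ 2 / 2 := le_of_mul_le_mul_left h4 ht2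
    have h6 : ρ ^ 2 ≤ 1 := by nlinarith
    nlinarith [sq_nonneg K]
  exact (pow_le_pow_iff_left₀ (norm_nonneg _) hK two_ne_zero).1 h3

/-- ★ **The sign condition**: under the same hypotheses and `K·t < 2`, the real part is POSITIVE (`re y/ρ ≥ 1 − K²t²/4 > 0`): the `t → 0`
configuration of such a blown-up point is the centre, not its antipode. [folklore] -/
theorem follower_re_pos {t K : ℝ} (ht : 0 < t) (hK : 0 ≤ K) (hKt : K * t < 2) {y : ℍ} (hv : dilateIm t y ≠ 0)
    (hfd : frobNorm (((quatToSU2 (dilateIm t y) : Matrix.specialUnitaryGroup (Fin 2) ℂ) : Matrix (Fin 2) (Fin 2) ℂ) - 1) ≤ K * t) :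
    0 < y.re := by
  set ρ : ℝ := ‖dilateIm t y‖ with hρ
  have hρ0 : 0 < ρ := norm_pos_iff.2 hv
  have hre : (dilateIm t y).re = y.re := by rw [dilateIm_apply]
  have hsq : 4 * (1 - y.re / ρ) ≤ (K * t) ^ 2 := by
    rw [← hre, hρ, ← frobNorm_quatToSU2_sub_one_sq hv]
    exact pow_le_pow_left₀ (frobNorm_nonneg _) hfd 2
  have hKt2 : (K * t) ^ 2 < 4 := by
    have h0 : 0 ≤ K * t := mul_nonneg hK ht.le
    nlinarith
  have hq : 0 < y.re / ρ := by linarith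
  have := mul_pos hq hρ0
  rwa [div_mul_cancel₀ _ hρ0.ne'] at this

/-! ## §3 The box has finite volume -/

/-- The follower box `{|re y| < 1, ‖Im y‖ ≤ K}` is bounded, hence of finite Lebesgue measure. [folklore] -/
theorem volume_followerBox_ne_top (K : ℝ) : volume {y : ℍ | |y.re| < 1 ∧ ‖y.im‖ ≤ K} ≠ ∞ := by
  refine (Bornology.IsBounded.measure_lt_top (μ := volume) ?_).ne
  rw [Metric.isBounded_iff_subset_closedBall (0 : ℍ)]
  refine ⟨1 + |K|, fun y hy => ?_⟩
  rcases hy with ⟨h1, h2⟩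
  rw [Metric.mem_closedBall, dist_zero_right]
  have hdec : y = (y.re : ℍ) + y.im := (Quaternion.re_add_im y).symm
  calc ‖y‖ = ‖(y.re : ℍ) + y.im‖ := by rw [← hdec]
    _ ≤ ‖(y.re : ℍ)‖ + ‖y.im‖ := norm_add_le _ _
    _ ≤ 1 + |K| := by
        rw [Quaternion.norm_coe, Real.norm_eq_abs]
        exact add_le_add h1.le (h2.trans (le_abs_self K))

/-- The `ι`-fold follower box has finite product Lebesgue measure. [folklore] -/
theorem pi_volume_followerBox_ne_top {ι : Type*} [Fintype ι] (K : ℝ) :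
    (Measure.pi fun _ : ι => (volume : Measure ℍ)) (Set.univ.pi fun _ : ι => {y : ℍ | |y.re| < 1 ∧ ‖y.im‖ ≤ K}) ≠ ∞ := by
  rw [Measure.pi_pi]
  exact ENNReal.prod_ne_top fun _ _ => volume_followerBox_ne_top K

end Summit.QuantumFields.YangMills.Theorems.SwapVirialDeficit.BlowUp

end
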